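import Literature.NumberTheory.Sieve.Maynard2016Lemma93Substitution
import Literature.NumberTheory.Sieve.Maynard2016Lemma85LamBound
import HarnessLib

/-!
# Maynard 2016, Lemma 9.3 for `𝒜 = ℤ` — step 2: the local factors as `μ(s)/φ(s)` (display (9.25))

Sources: J. Maynard, *Dense clusters of primes in subsets*, Compositio Math. 152 (2016) 1517–1554 =
arXiv:1405.2593 [Maynard2016DenseClusters], proof of Lemma 9.3, p. 23 (displays (9.23)–(9.25) and
the paragraph «We let e_j = r_j s_j t_j …»); K. Ford, B. Green, S. Konyagin, J. Maynard, T. Tao,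
*Long gaps between primes*, JAMS 31 (2018) [FordGreenKonyaginMaynardTao2018], Theorem 6 (7.13).

Continuing `Maynard2016Lemma93Substitution` (display (9.23)): writing `e = r ⊙ q` (`q_j = e_j/r_j`),
`φ_ω(e) = φ_ω(r) φ_ω(∏ q_j)` so that
`y^{(m)}_r = (r/φ_L(r)) ∑_{e ∈ 𝒟_k, r ∣ e} y_e σ(r,e)/φ_ω(∏ e_j/r_j)` (`yVarM_eq_sum_yVar_quot`), and the
product of local factors `σ(r,e) = ∏_j ∏_{p ∣ e_j/r_j} S'^{(m)}_p(j)` is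

* `0` as soon as some prime `p ∣ e_j/r_j` (`j ≠ m`, `p ∤ a_j b_m − a_m b_j`) divides `a_m`
  (`sPrimeProdM_eq_zero`: Maynard's restriction «`(s_j, a_m) = 1`»), and otherwise
* `∏_{j ≠ m} ∏_{p ∣ e_j/r_j, p ∤ a_j b_m − a_m b_j} (−1/(p−1))` (`sPrimeProdM_eq_prod`), i.e. `μ(s)/φ(s)`
  for `s` the product of those primes (`prod_primeFactors_neg_one_div_eq` : `∏_{p∣s}(−1/(p−1)) = μ(s)/φ(s)`
  for square-free `s`) — display (9.25).

## References
* J. Maynard, *Dense clusters of primes in subsets*, Compositio Math. 152 (2016), proof of Lemma 9.3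
  p. 23, (9.23)–(9.25) [Maynard2016DenseClusters].
* K. Ford, B. Green, S. Konyagin, J. Maynard, T. Tao, *Long gaps between primes*, JAMS 31 (2018),
  Thm 6 (7.13) [FordGreenKonyaginMaynardTao2018].
-/

noncomputable section

open Finset
open scoped ArithmeticFunction.Moebius ArithmeticFunction.omega ArithmeticFunction.Omega

namespace Literature.NumberTheory.Sieve.FGKMT2018

variable {k : ℕ}

/-! ### The quotient vector `q = e/r` -/

/-- `∏ rᵢ · ∏ (eᵢ/rᵢ) = ∏ eᵢ` when `r ∣ e` coordinatewise. [folklore] -/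
private theorem prod_mul_prod_div_eq {r e : Fin k → ℕ} (hre : ∀ i, r i ∣ e i) :
    (∏ i, r i) * ∏ i, e i / r i = ∏ i, e i := by
  rw [← Finset.prod_mul_distrib]
  exact Finset.prod_congr rfl fun i _ => Nat.mul_div_cancel' (hre i)

/-- `φ_ω(∏ eᵢ) = φ_ω(∏ rᵢ) φ_ω(∏ eᵢ/rᵢ)` for `e ∈ 𝒟_k`, `r ∣ e` (`∏ eᵢ` is square-free).
[cite: Maynard2016DenseClusters, proof of Lemma 9.3 p. 23 («by multiplicativity»)] -/
theorem phiOmega_prod_eq_mul_quot (L : Fin k → ℤ × ℤ) {B : ℕ} {R : ℝ} {r e : Fin k → ℕ}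
    (he : e ∈ dkBox L B R) (hre : ∀ i, r i ∣ e i) :
    phiOmega L (∏ i, e i) = phiOmega L (∏ i, r i) * phiOmega L (∏ i, e i / r i) := by
  have hsq : Squarefree ((∏ i, r i) * ∏ i, e i / r i) := by
    rw [prod_mul_prod_div_eq hre]; exact squarefree_of_mem_dkBox he
  rw [← prod_mul_prod_div_eq hre, phiOmega_mul_of_coprime L (Nat.squarefree_mul_iff.1 hsq).1]

/-- **Display (9.23), quotient form**: for `r ∈ 𝒟'_k`, `r_m = 1`,
`y^{(m)}_r = (r/φ_L(r)) ∑_{e ∈ 𝒟_k, r ∣ e} y_e σ(r,e)/φ_ω(∏ eᵢ/rᵢ)`.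
[cite: Maynard2016DenseClusters, proof of Lemma 9.3 p. 23, (9.23) and (9.26) (the factor r/φ_L(r))] -/
theorem yVarM_eq_sum_yVar_quot {L : Fin k → ℤ × ℤ} (hadm : FormsAdmissible L) {B : ℕ} {R : ℝ}
    (F : (Fin k → ℝ) → ℝ) {m : Fin k} {r : Fin k → ℕ} (hr : r ∈ dkBoxP L B R m) :
    yVarM L B R F m r =
      (∏ i, r i : ℕ) / totForm (L m) (∏ i, r i) *
        ∑ e ∈ (dkBox L B R).filter (fun e => ∀ i, r i ∣ e i),
          yVar L B R F e * sPrimeProdM L m r e / phiOmega L (∏ i, e i / r i) := by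
  rw [yVarM_eq_sum_yVar hadm F hr, Finset.mul_sum, Finset.mul_sum]
  refine Finset.sum_congr rfl fun e he => ?_
  obtain ⟨hebox, hre⟩ := Finset.mem_filter.1 he
  have hφr : phiOmega L (∏ i, r i) ≠ 0 :=
    (phiOmega_prod_pos_of_mem_dkBox hadm (dkBoxP_subset L B R m hr)).ne'
  rw [phiOmega_prod_eq_mul_quot L hebox hre]
  field_simp

/-! ### The local factors: `0` or `μ(s)/φ(s)` -/

/-- If a prime `p ∣ e_j/r_j` (`j ≠ m`, `p ∤ a_j b_m − a_m b_j`) divides `a_m`, the product of local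
factors vanishes (Maynard: «we can restrict to `(s_j, a_m) = 1`»).
[cite: Maynard2016DenseClusters, proof of Lemma 9.3 p. 23, (9.24)–(9.25)] -/
theorem sPrimeProdM_eq_zero (L : Fin k → ℤ × ℤ) {m : Fin k} (hl : (L m).1 ≠ 0) (r e : Fin k → ℕ)
    {j : Fin k} (hjm : j ≠ m) {p : ℕ} (hp : p ∈ (e j / r j).primeFactors)
    (hΔ : ¬ p ∣ (crossDet L m j).natAbs) (ha : p ∣ (L m).1.natAbs) : sPrimeProdM L m r e = 0 := by
  unfold sPrimeProdM
  refine Finset.prod_eq_zero (Finset.mem_univ j) (Finset.prod_eq_zero hp ?_)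
  have h : ¬ (j = m ∨ p ∣ (crossDet L m j).natAbs) := by
    rintro (h | h)
    · exact hjm h
    · exact hΔ h
  rw [sPrimeM_of_not L hl (Nat.prime_of_mem_primeFactors hp) h, if_pos ha]

/-- Otherwise `σ(r,e) = ∏_{j ≠ m} ∏_{p ∣ e_j/r_j, p ∤ a_j b_m − a_m b_j} (−1/(p−1))` (the primes at
index `m` and those dividing `a_j b_m − a_m b_j` — Maynard's `e_m` and `t_j` — contribute `1`).
[cite: Maynard2016DenseClusters, proof of Lemma 9.3 p. 23, (9.24)–(9.25)] -/
theorem sPrimeProdM_eq_prod (L : Fin k → ℤ × ℤ) {m : Fin k} (hl : (L m).1 ≠ 0) (r e : Fin k → ℕ)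
    (h : ∀ j, j ≠ m → ∀ p ∈ (e j / r j).primeFactors, ¬ p ∣ (crossDet L m j).natAbs →
      ¬ p ∣ (L m).1.natAbs) :
    sPrimeProdM L m r e =
      ∏ j ∈ Finset.univ.erase m,
        ∏ p ∈ (e j / r j).primeFactors.filter (fun p => ¬ p ∣ (crossDet L m j).natAbs),
          (-1 / ((p : ℝ) - 1)) := by
  classical
  unfold sPrimeProdM
  rw [← Finset.mul_prod_erase Finset.univ _ (Finset.mem_univ m)]
  have hm : ∏ p ∈ (e m / r m).primeFactors, sPrimeM L m m p = 1 := by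
    refine Finset.prod_eq_one fun p _ => ?_
    unfold sPrimeM
    rw [if_pos (Or.inl rfl)]
  rw [hm, one_mul]
  refine Finset.prod_congr rfl fun j hj => ?_
  have hjm : j ≠ m := Finset.ne_of_mem_erase hj
  rw [← Finset.prod_filter_mul_prod_filter_not (e j / r j).primeFactors
    (fun p => ¬ p ∣ (crossDet L m j).natAbs)]
  have h1 : ∏ p ∈ (e j / r j).primeFactors.filter (fun p => ¬ ¬ p ∣ (crossDet L m j).natAbs),
      sPrimeM L m j p = 1 := by
    refine Finset.prod_eq_one fun p hp => ?_
    obtain ⟨-, hpΔ⟩ := Finset.mem_filter.1 hp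
    unfold sPrimeM
    rw [if_pos (Or.inr (not_not.1 hpΔ))]
  rw [h1, mul_one]
  refine Finset.prod_congr rfl fun p hp => ?_
  obtain ⟨hpf, hpΔ⟩ := Finset.mem_filter.1 hp
  have hno : ¬ (j = m ∨ p ∣ (crossDet L m j).natAbs) := by
    rintro (h' | h')
    · exact hjm h'
    · exact hpΔ h'
  rw [sPrimeM_of_not L hl (Nat.prime_of_mem_primeFactors hpf) hno, if_neg (h j hjm p hpf hpΔ)]

/-- `φ(s) = ∏_{p ∣ s} (p − 1)` for square-free `s`. [folklore] -/
private theorem totient_eq_prod_sub_one_of_squarefree {s : ℕ} (hs : Squarefree s) :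
    (Nat.totient s : ℝ) = ∏ p ∈ s.primeFactors, ((p : ℝ) - 1) := by
  have h := Nat.totient_mul_prod_primeFactors s
  rw [Nat.prod_primeFactors_of_squarefree hs] at h
  have hs0 : s ≠ 0 := hs.ne_zero
  have h' : Nat.totient s = ∏ p ∈ s.primeFactors, (p - 1) :=
    Nat.eq_of_mul_eq_mul_right (Nat.pos_of_ne_zero hs0) (by rw [h, mul_comm])
  rw [h', Nat.cast_prod]
  refine Finset.prod_congr rfl fun p hp => ?_
  rw [Nat.cast_sub (Nat.prime_of_mem_primeFactors hp).one_le, Nat.cast_one]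

/-- `μ(s) = (−1)^{#primes of s}` for square-free `s`. [folklore] -/
private theorem moebius_eq_neg_one_pow_card_of_squarefree {s : ℕ} (hs : Squarefree s) :
    μ s = (-1) ^ s.primeFactors.card := by
  rw [ArithmeticFunction.moebius_apply_of_squarefree hs, ArithmeticFunction.cardFactors_apply,
    ← List.toFinset_card_of_nodup hs.nodup_primeFactorsList]
  rfl

/-- **`∏_{p ∣ s} (−1/(p−1)) = μ(s)/φ(s)`** for square-free `s` — so the local factors of (9.24) are
`μ(s)/φ(s)` (display (9.25)). [cite: Maynard2016DenseClusters, proof of Lemma 9.3 p. 23, (9.25)] -/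
theorem prod_primeFactors_neg_one_div_eq {s : ℕ} (hs : Squarefree s) :
    ∏ p ∈ s.primeFactors, (-1 / ((p : ℝ) - 1)) = (μ s : ℝ) / Nat.totient s := by
  rw [Finset.prod_div_distrib, Finset.prod_const, totient_eq_prod_sub_one_of_squarefree hs,
    moebius_eq_neg_one_pow_card_of_squarefree hs]
  push_cast
  ring

end Literature.NumberTheory.Sieve.FGKMT2018
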